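import Summits.HubbardSuperconductivity.HubbardSuperconductivity.Theorems.AnisotropyChordTransferFibre3FinRCCell

/-!
# Route `AnisotropyChord` / H0 rotor rung: FIN layer 3e — NUMERATOR VACUITY (the regime certificate past the pole of the regularised `Δ(λ)`)

For `L ≥ 17` the regularised denominator `den(λ) = 4 + (V−1)λ − V(4−λ)λG₀(λ)` of `Δ(λ) = num/den` has a zero INSIDE the a-priori
window `λ ≤ .0982θ²`, so the cell check `groundCellCheck` (`lo den > 0`) of `…FinGroundCell` cannot hold on the whole window.  The
cure is elementary: if `num = 4 − 4VλG₀ < 0` (and `G₀ ≥ 0`) the cell carries NO ground state with `0 < Δ < 1` whatever the sign of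
`den` — `den > 0 ⇒ Δ < 0`, `den < 0 ⇒ Δ > 1` (because `num − den = −(V−1)λ − Vλ²G₀ < 0`), `den = 0 ⇒ Δ = num/0 = 0` (`vacuous_of_num_neg`).
`mholeCellOK5` adds this branch in front of the row–column certificate of `…FinRCCell`; `mholeCheck5`; ★ `mHole_nonneg_of_cells5`.
Since `num` is decreasing in `λ`, every cell beyond the `Δ = 0` crossing is numerator-vacuous (one or two cells cover the top of the window).
Prover seat `hubbard-h0-rotor-p3` g4; helper for stmt-HubbardSuperconductivity-23918 (piece A of rung 19089; `--supports`, helper class).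
WHAT THIS IS NOT: nothing here proves superconductivity in the Hubbard model; soundness of a FIN certificate for the regime
clause of one conditional reduction. Tree imports only; no sorry.
-/

set_option linter.dupNamespace false
set_option autoImplicit false

noncomputable section

namespace Summit.HubbardSuperconductivity.HubbardSuperconductivity.Theorems.AnisotropyChord.Transfer.Fibre3

namespace FinCell

open scoped BigOperators
open Finset Hole2

variable (L : ℕ) [NeZero L]

/-! ## Layer 3e: the certificate with the numerator-vacuity branch (computable, zero data) -/

/-- one cell: momentum positivity, then EITHER numerator vacuity (`hi num < 0`, `lo G₀ ≥ 0`) OR the row–column certificate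
(`lo w > 0`, `lo den > 0`, then `Δ`-vacuity or the `T⁺` bound). [folklore] -/
def mholeCellOK5 (L : ℕ) (la lb : ℤ) : Bool :=
  denCellPos L (cosTab L) la lb &&
    ((decide ((numIv L la lb).2 < 0) && decide (0 ≤ (G0Iv L la lb).1)) ||
      (decide (0 < (wIv L la lb).1) && decide (0 < (denIv L la lb).1) &&
        (decide ((deltaIv L la lb).2 < 0) ||
          (decide (0 < (NIv3 L (fTab4 L la lb)).1) && decide ((tplusIv4 L la lb).2 ≤ (boundIv L).1)))))

/-- ★ the per-`L` certificate with numerator vacuity. [folklore] -/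
def mholeCheck5 (L : ℕ) (cells : List ℤ) : Bool :=
  decide (cells.head? = some 0) && decide (2 ≤ cells.length) && decide (lamTop L ≤ cellsLast cells)
    && cellsAll (mholeCellOK5 L) cells

/-! ## Soundness -/

variable {L}

/-- ★ NUMERATOR VACUITY: `num < 0` and `G₀ ≥ 0` on the cell exclude every `Δ = Δ(λ) ∈ (0,1)`. [folklore] -/
theorem vacuous_of_num_neg (hL : 3 ≤ L) {lam : ℝ} (hlam : 0 < lam) {la lb : ℤ}
    (hla : (la : ℝ) ≤ lam * ((D : ℤ) : ℝ)) (hlb : lam * ((D : ℤ) : ℝ) ≤ (lb : ℝ))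
    (hpos : denCellPos L (cosTab L) la lb = true)
    (hnum : (numIv L la lb).2 < 0) (hG0 : 0 ≤ (G0Iv L la lb).1)
    {Δ : ℝ} (hΔ0 : 0 < Δ) (hΔ1 : Δ < 1) (hΔe : Δ = deltaOfLam L lam) : False := by
  have hD := D_pos
  have hV : (1 : ℝ) ≤ (L : ℝ) ^ 2 := by
    have : (3 : ℝ) ≤ L := by exact_mod_cast hL
    nlinarith
  set G : ℝ := Gres L lam 0 with hG
  have hGnn : 0 ≤ G := by
    obtain ⟨hlo, _⟩ := mem_G0_cell L hL hla hlb hpos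
    have : (0 : ℝ) ≤ (((G0Iv L la lb).1 : ℤ) : ℝ) := by exact_mod_cast hG0
    nlinarith
  have hnum' : 4 - 4 * (L : ℝ) ^ 2 * lam * G < 0 := by
    obtain ⟨_, hhi⟩ := mem_num_cell L hL hla hlb hpos
    have : ((((numIv L la lb).2 : ℤ)) : ℝ) < 0 := by exact_mod_cast hnum
    nlinarith
  rw [deltaOfLam_eq_reg L hlam.ne'] at hΔe
  set num : ℝ := 4 - 4 * (L : ℝ) ^ 2 * lam * G with hnumdef
  set den : ℝ := 4 + ((L : ℝ) ^ 2 - 1) * lam - (L : ℝ) ^ 2 * (4 - lam) * lam * G with hdendef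
  rcases lt_trichotomy den 0 with hden | hden | hden
  · -- `den < 0`: `Δ = num/den > 1`
    have h1 : den < num := by
      rw [hΔe] at hΔ1
      exact (div_lt_one_of_neg hden).mp hΔ1
    have h2 : num - den = -(((L : ℝ) ^ 2 - 1) * lam) - (L : ℝ) ^ 2 * lam ^ 2 * G := by
      rw [hnumdef, hdendef]; ring
    have h3 : 0 ≤ ((L : ℝ) ^ 2 - 1) * lam := by nlinarith
    have h4 : 0 ≤ (L : ℝ) ^ 2 * lam ^ 2 * G := by positivity
    linarith
  · -- `den = 0`: `Δ = num/0 = 0`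
    rw [hden, div_zero] at hΔe
    linarith
  · -- `den > 0`: `Δ = num/den < 0`
    have : Δ < 0 := by rw [hΔe]; exact div_neg_of_neg_of_pos hnum' hden
    linarith

variable (L)

/-- ★★ SOUNDNESS WITH NUMERATOR VACUITY: `mholeCheck5 L cells = true` ⇒ `0 ≤ mHole L Δ f` for every ground profile, every
`0 < Δ < 1` (`7 ≤ L`). [folklore] -/
theorem mHole_nonneg_of_cells5 (hL : 7 ≤ L) (cells : List ℤ) (hchk : mholeCheck5 L cells = true)
    {Δ : ℝ} (hΔ0 : 0 < Δ) (hΔ1 : Δ < 1) :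
    ∀ lam2 : ℝ, ∀ f : Tor L → ℝ, IsGroundTwoMagnon L Δ lam2 f → 0 ≤ mHole L Δ f := by
  refine forall_ground_of_window_7 L hL hΔ0.le hΔ1 (fun _ f => 0 ≤ mHole L Δ f) ?_
  intro lam2 f hf hlam0 hlamle
  have hD := D_pos
  unfold mholeCheck5 at hchk
  simp only [Bool.and_eq_true, decide_eq_true_eq] at hchk
  obtain ⟨⟨⟨hhead, hlen⟩, htop⟩, hok⟩ := hchk
  obtain ⟨a, b, rest, hcells⟩ : ∃ a b : ℤ, ∃ rest : List ℤ, cells = a :: b :: rest := by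
    match cells, hlen with
    | a :: b :: rest, _ => exact ⟨a, b, rest, rfl⟩
  subst hcells
  have ha0 : a = 0 := by simpa using hhead
  subst ha0
  set x : ℝ := lam2 * ((D : ℤ) : ℝ) with hx
  have hx0 : ((0 : ℤ) : ℝ) ≤ x := by rw [hx]; push_cast; positivity
  have hxtop : x ≤ ((cellsLast ((0 : ℤ) :: b :: rest) : ℤ) : ℝ) :=
    (lam_mul_D_le_lamTop L (by omega) hlamle).trans (by exact_mod_cast htop)
  obtain ⟨c, d, hcell, hcx, hxd⟩ := cover_all (mholeCellOK5 L) rest 0 b x hok hx0 hxtop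
  have hfe : f = groundF L lam2 := ground_eq_explicit L (by omega) hΔ0.le hΔ1 hf
  have hΔe : Δ = deltaOfLam L lam2 := ground_delta_eq L (by omega) hΔ0.le hΔ1 hf
  have hf2 : IsTwoMagnon L Δ lam2 f := hf.1
  have hev : ∀ r : Tor L, f (-r) = f r := hf.2.1
  have hsw : ∀ r : Tor L, f (r.2, r.1) = f r := by
    intro r; rw [hfe]; exact groundF_swap lam2 r
  unfold mholeCellOK5 at hcell
  simp only [Bool.and_eq_true, Bool.or_eq_true, decide_eq_true_eq] at hcell
  obtain ⟨hpos, hcase⟩ := hcell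
  rcases hcase with ⟨hnum, hG0⟩ | ⟨⟨hw, hden⟩, hcase2⟩
  · -- numerator vacuity
    exfalso
    exact vacuous_of_num_neg (by omega) hlam0 hcx hxd hpos hnum hG0 hΔ0 hΔ1 hΔe
  · have hgc : groundCellCheck L c d = true := by
      unfold groundCellCheck
      simp only [Bool.and_eq_true, decide_eq_true_eq]
      exact ⟨⟨hpos, hw⟩, hden⟩
    rcases hcase2 with hvac | ⟨hN, hT⟩
    · -- `Δ`-vacuity
      exfalso
      have hmd := mem_delta_cell L (by omega) hlam0 hcx hxd hgc
      rw [← hΔe] at hmd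
      obtain ⟨_, hhi⟩ := hmd
      have : ((((deltaIv L c d).2 : ℤ)) : ℝ) < 0 := by exact_mod_cast hvac
      nlinarith
    · have htab : TabEncl L f (fTab4 L c d) := by
        rw [hfe]; exact tabEncl_fTab4 (by omega) hlam0 hcx hxd hgc
      have horc : ∀ e1 e2 r1 r2 : ℕ, e1 < L → e2 < L → r1 < L → r2 < L →
          mem (Dgrad L f ((((e1 : ℕ) : ZMod L)), (((e2 : ℕ) : ZMod L))) ((((r1 : ℕ) : ZMod L)), (((r2 : ℕ) : ZMod L))))
            (cellOracle4 L c d e1 e2 r1 r2) := by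
        rw [hfe]; exact mem_cellOracle4 (by omega) hlam0 hcx hxd hgc
      have mN : mem (PiNormSq L f) (NIv3 L (fTab4 L c d)) := mem_NIv3 htab
      have mS : mem (∑ cc : Cfg L, piR L f cc * C0fn L Δ lam2 f cc) (SIv3 L (fTab4 L c d) (cellOracle4 L c d)) :=
        mem_SIv3 (by omega) hf2 hev hsw htab horc
      have hNpos : 0 < PiNormSq L f := by
        obtain ⟨hlo, _⟩ := mN
        have : (0 : ℝ) < (((NIv3 L (fTab4 L c d)).1 : ℤ) : ℝ) := by exact_mod_cast hN
        nlinarith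
      have hS := sum_piR_C0fn L hf2
      have hTeq : Tplus L Δ f = 3 * lam2 + (∑ cc : Cfg L, piR L f cc * C0fn L Δ lam2 f cc) * (1 / PiNormSq L f) := by
        rw [hS]; field_simp; ring
      have mT : mem (Tplus L Δ f) (tplusIv4 L c d) := by
        rw [hTeq]
        unfold tplusIv4
        have h3 : mem (3 * lam2) (iscale 3 (c, d)) := by
          have := mem_iscale 3 (mem_lam hcx hxd); push_cast at this; exact this
        exact mem_iadd h3 (mem_imul mS (mem_iinv mN hN))
      have mB := mem_bound L (by omega)
      obtain ⟨_, hThi⟩ := mT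
      obtain ⟨hBlo, _⟩ := mB
      have hle : ((((tplusIv4 L c d).2 : ℤ)) : ℝ) ≤ ((((boundIv L).1 : ℤ)) : ℝ) := by exact_mod_cast hT
      unfold mHole
      nlinarith

end FinCell

end Summit.HubbardSuperconductivity.HubbardSuperconductivity.Theorems.AnisotropyChord.Transfer.Fibre3

end
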